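import Summits.QuantumAdvantage.QuantumAdvantage.Theorems.CubicForrelationSignedExactCubicForrelationNotPrBPPStubCubeKernelStats

/-!
# Crux `CubicForrelation.SignedExactCubicForrelationNotPrBPP` (stmt-QuantumAdvantage-13932), line `dual-pingpong-frame`
# (classify-then-count cut): stub `stub_cubeBlockSums` (H4) — the `𝔽₈` cube, its inverse, and block nondegeneracy

Support file 1/5 (`--supports stmt-QuantumAdvantage-13932`) for the registered stub `stub_cubeBlockSums` = KERNEL
STATISTICS OF CUBE-ORBIT INSTANCES AT EVERY CLOSED ORTHOGONAL PROPER PAIR. Namespace `CubeBS` (block sums); it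
reuses W1's one-block calculus `CubeKS.cubeF / Bc / bd3 / blk / glue / embed / cubeP / Bv` verbatim.

* `cubeInvF` — the inverse `x ↦ x⁵` of the `𝔽₈` cube in the coordinates of the registered statement (`cubeInvF_cubeF`,
  `cubeF_cubeInvF` by `decide`), its bilinear differential `Bci`, translation invariance of `Bci` (`Bci_shift`: the
  inverse is quadratic), blockwise versions `cubePinv`, `blk_cubePinv`.
* The template permutation WITH A LINEAR TERM: `piL k ℓ y = cube^k(y) ⊕ ℓ` (so that
  `y'·piL(y'') = y'·cube^k(y'') ⊕ ℓ·y'`) as an `Equiv` `permL k ℓ` with inverse `x ↦ cube^{-k}(x ⊕ ℓ)`; its bilinear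
  differential is that of `cube^k` (`Bv_piL`, `piL_pair`), the one of its inverse is blockwise `Bci` (`blk_Bv_sigL`).
* **Block nondegeneracy** (`nd1`, `nd2`, from the `decide`d one-block facts `nd1_aux`, `nd2_aux`): if
  `B_σ(B_π(t, y), B_π(t, y₂)) = 0` for all `y, y₂` then `t = 0` (and dually with `π ↔ σ`): the image of `B_π(t,·)`
  in a block where `t ≠ 0` is a plane of `𝔽₂³`, on which the APN differential of the inverse cannot vanish.

References: K. Nyberg, *Differentially uniform mappings for cryptography*, EUROCRYPT '93 (Gold power maps and their
inverses are APN) [Nyberg1994]; C. Carlet, *Boolean Functions for Cryptography and Coding Theory*, CUP 2021, §11.3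
[Carlet2020]. -/

noncomputable section

set_option linter.dupNamespace false -- D-0017: single-problem summit ⇒ `QuantumAdvantage.QuantumAdvantage` by design

namespace Summit.QuantumAdvantage.QuantumAdvantage.Theorems.SignedExactCubicForrelationNotPrBPP

open Finset
open Literature.Computability.Complexity Literature.Computability.QuantumComplexity
open Literature.Computability.QuantumComplexity.BuzetChailloux (bxor zeroVec bxor_self bxor_comm
  bxor_zeroVec zeroVec_bxor bxor_bxor_cancel_left)
open CubeKS

namespace CubeBS

/-! ### The inverse of the `𝔽₈` cube on one block -/

/-- The inverse `x ↦ x⁵` of the `𝔽₈` cube `CubeKS.cubeF`, in coordinates. [folklore] -/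
def cubeInvF (x : Fin 3 → Bool) : Fin 3 → Bool :=
  ![x 2 ^^ x 1 ^^ (x 1 && x 2) ^^ x 0, x 2 ^^ x 1 ^^ (x 0 && x 2), x 1 ^^ (x 0 && x 2) ^^ (x 0 && x 1)]

/-- The bilinear differential of the inverse cube on one block. [folklore] -/
def Bci (t u : Fin 3 → Bool) : Fin 3 → Bool :=
  fun s => cubeInvF (bxor t u) s ^^ cubeInvF t s ^^ cubeInvF u s ^^ cubeInvF zeroVec s

/-- `cubeInvF ∘ cubeF = id`, coordinate form. [folklore] -/
theorem cubeInvF_cubeF_aux : ∀ x0 x1 x2 : Bool,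
    cubeInvF (cubeF ![x0, x1, x2]) 0 = x0 ∧ cubeInvF (cubeF ![x0, x1, x2]) 1 = x1 ∧
      cubeInvF (cubeF ![x0, x1, x2]) 2 = x2 := by
  decide

/-- `cubeInvF ∘ cubeF = id`. [folklore] -/
theorem cubeInvF_cubeF (x : Fin 3 → Bool) : cubeInvF (cubeF x) = x := by
  have eta3 : ∀ w : Fin 3 → Bool, w = ![w 0, w 1, w 2] := fun w => by funext s; fin_cases s <;> rfl
  obtain ⟨h0, h1, h2⟩ := cubeInvF_cubeF_aux (x 0) (x 1) (x 2)
  rw [← eta3 x] at h0 h1 h2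
  funext s; fin_cases s
  · exact h0
  · exact h1
  · exact h2

/-- `cubeF ∘ cubeInvF = id`, coordinate form. [folklore] -/
theorem cubeF_cubeInvF_aux : ∀ x0 x1 x2 : Bool,
    cubeF (cubeInvF ![x0, x1, x2]) 0 = x0 ∧ cubeF (cubeInvF ![x0, x1, x2]) 1 = x1 ∧
      cubeF (cubeInvF ![x0, x1, x2]) 2 = x2 := by
  decide

/-- `cubeF ∘ cubeInvF = id`. [folklore] -/
theorem cubeF_cubeInvF (x : Fin 3 → Bool) : cubeF (cubeInvF x) = x := by
  have eta3 : ∀ w : Fin 3 → Bool, w = ![w 0, w 1, w 2] := fun w => by funext s; fin_cases s <;> rfl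
  obtain ⟨h0, h1, h2⟩ := cubeF_cubeInvF_aux (x 0) (x 1) (x 2)
  rw [← eta3 x] at h0 h1 h2
  funext s; fin_cases s
  · exact h0
  · exact h1
  · exact h2

/-- **The inverse cube is quadratic**: its bilinear differential is translation invariant (coordinate form).
[cite: Nyberg1994] -/
theorem Bci_shift_aux : ∀ a0 a1 a2 b0 b1 b2 l0 l1 l2 : Bool, ∀ s : Fin 3,
    (cubeInvF (bxor (bxor ![a0, a1, a2] ![b0, b1, b2]) ![l0, l1, l2]) s ^^
      cubeInvF (bxor ![a0, a1, a2] ![l0, l1, l2]) s ^^ cubeInvF (bxor ![b0, b1, b2] ![l0, l1, l2]) s ^^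
        cubeInvF ![l0, l1, l2] s) = Bci ![a0, a1, a2] ![b0, b1, b2] s := by
  decide

/-- **The inverse cube is quadratic**: `ci(a⊕b⊕l) ⊕ ci(a⊕l) ⊕ ci(b⊕l) ⊕ ci(l) = Bci a b`. [cite: Nyberg1994] -/
theorem Bci_shift (a b l : Fin 3 → Bool) (s : Fin 3) :
    (cubeInvF (bxor (bxor a b) l) s ^^ cubeInvF (bxor a l) s ^^ cubeInvF (bxor b l) s ^^ cubeInvF l s) =
      Bci a b s := by
  have eta3 : ∀ w : Fin 3 → Bool, w = ![w 0, w 1, w 2] := fun w => by funext s; fin_cases s <;> rfl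
  have h := Bci_shift_aux (a 0) (a 1) (a 2) (b 0) (b 1) (b 2) (l 0) (l 1) (l 2) s
  rwa [← eta3 a, ← eta3 b, ← eta3 l] at h

/-- Boolean bookkeeping: `(0 ∨ 0 ∨ 0) = false` read on the zero vector of `𝔽₂³`. [folklore] -/
theorem or3_zeroVec :
    ((zeroVec : Fin 3 → Bool) 0 || (zeroVec : Fin 3 → Bool) 1 || (zeroVec : Fin 3 → Bool) 2) = false := rfl

/-- **Block nondegeneracy, `π`-side** (exhaustive check over `t ∈ 𝔽₂³ ∖ 0`): among the three pairs of unit vectors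
`(y, y₂)` one has `Bci (Bc t y) (Bc t y₂) ≠ 0` (some coordinate is `true`). [folklore] -/
theorem nd1_aux : ∀ t0 t1 t2 : Bool, (t0 || t1 || t2) = true →
    ((Bci (Bc ![t0, t1, t2] ![true, false, false]) (Bc ![t0, t1, t2] ![false, true, false]) 0 ||
      Bci (Bc ![t0, t1, t2] ![true, false, false]) (Bc ![t0, t1, t2] ![false, true, false]) 1 ||
      Bci (Bc ![t0, t1, t2] ![true, false, false]) (Bc ![t0, t1, t2] ![false, true, false]) 2) ||
     (Bci (Bc ![t0, t1, t2] ![true, false, false]) (Bc ![t0, t1, t2] ![false, false, true]) 0 ||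
      Bci (Bc ![t0, t1, t2] ![true, false, false]) (Bc ![t0, t1, t2] ![false, false, true]) 1 ||
      Bci (Bc ![t0, t1, t2] ![true, false, false]) (Bc ![t0, t1, t2] ![false, false, true]) 2) ||
     (Bci (Bc ![t0, t1, t2] ![false, true, false]) (Bc ![t0, t1, t2] ![false, false, true]) 0 ||
      Bci (Bc ![t0, t1, t2] ![false, true, false]) (Bc ![t0, t1, t2] ![false, false, true]) 1 ||
      Bci (Bc ![t0, t1, t2] ![false, true, false]) (Bc ![t0, t1, t2] ![false, false, true]) 2)) = true := by
  decide

/-- **Block nondegeneracy, `σ`-side** (exhaustive check over `u ∈ 𝔽₂³ ∖ 0`). [folklore] -/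
theorem nd2_aux : ∀ u0 u1 u2 : Bool, (u0 || u1 || u2) = true →
    ((Bc (Bci ![u0, u1, u2] ![true, false, false]) (Bci ![u0, u1, u2] ![false, true, false]) 0 ||
      Bc (Bci ![u0, u1, u2] ![true, false, false]) (Bci ![u0, u1, u2] ![false, true, false]) 1 ||
      Bc (Bci ![u0, u1, u2] ![true, false, false]) (Bci ![u0, u1, u2] ![false, true, false]) 2) ||
     (Bc (Bci ![u0, u1, u2] ![true, false, false]) (Bci ![u0, u1, u2] ![false, false, true]) 0 ||
      Bc (Bci ![u0, u1, u2] ![true, false, false]) (Bci ![u0, u1, u2] ![false, false, true]) 1 ||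
      Bc (Bci ![u0, u1, u2] ![true, false, false]) (Bci ![u0, u1, u2] ![false, false, true]) 2) ||
     (Bc (Bci ![u0, u1, u2] ![false, true, false]) (Bci ![u0, u1, u2] ![false, false, true]) 0 ||
      Bc (Bci ![u0, u1, u2] ![false, true, false]) (Bci ![u0, u1, u2] ![false, false, true]) 1 ||
      Bc (Bci ![u0, u1, u2] ![false, true, false]) (Bci ![u0, u1, u2] ![false, false, true]) 2)) = true := by
  decide

/-- One-block form of `nd1`: if `Bci (Bc t y) (Bc t y₂) = 0` for all `y, y₂ ∈ 𝔽₂³` then `t = 0`. [folklore] -/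
theorem nd1_block {t : Fin 3 → Bool} (h : ∀ y y₂ : Fin 3 → Bool, Bci (Bc t y) (Bc t y₂) = zeroVec) :
    t = zeroVec := by
  by_contra ht
  have key := nd1_aux (t 0) (t 1) (t 2) (or3_of_ne_zeroVec ht)
  have eta3 : ∀ w : Fin 3 → Bool, w = ![w 0, w 1, w 2] := fun w => by funext s; fin_cases s <;> rfl
  rw [← eta3 t, h, h, h, or3_zeroVec] at key
  exact Bool.noConfusion key

/-- One-block form of `nd2`: if `Bc (Bci u x) (Bci u x₂) = 0` for all `x, x₂ ∈ 𝔽₂³` then `u = 0`. [folklore] -/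
theorem nd2_block {u : Fin 3 → Bool} (h : ∀ x x₂ : Fin 3 → Bool, Bc (Bci u x) (Bci u x₂) = zeroVec) :
    u = zeroVec := by
  by_contra hu
  have key := nd2_aux (u 0) (u 1) (u 2) (or3_of_ne_zeroVec hu)
  have eta3 : ∀ w : Fin 3 → Bool, w = ![w 0, w 1, w 2] := fun w => by funext s; fin_cases s <;> rfl
  rw [← eta3 u, h, h, h, or3_zeroVec] at key
  exact Bool.noConfusion key

/-! ### Blockwise: the inverse cube on `𝔽₂^(k·3)` and the template permutation with a linear term -/

variable {k : ℕ}

/-- `cube^{-k}`, blockwise inverse cube (same indexing as the registered `cube^k`). [folklore] -/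
def cubePinv (k : ℕ) (x : Fin (k * 3) → Bool) : Fin (k * 3) → Bool :=
  fun i => cubeInvF (fun s => x (finProdFinEquiv ((finProdFinEquiv.symm i).1, s))) (finProdFinEquiv.symm i).2

/-- `cube^{-k}` acts blockwise. [folklore] -/
theorem blk_cubePinv (x : Fin (k * 3) → Bool) (q : Fin k) : blk (cubePinv k x) q = cubeInvF (blk x q) := by
  show blk (glue fun q => cubeInvF (blk x q)) q = _
  rw [blk_glue]

/-- `cube^{-k} ∘ cube^k = id`. [folklore] -/
theorem cubePinv_cubeP (y : Fin (k * 3) → Bool) : cubePinv k (cubeP k y) = y :=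
  eq_of_blk_eq fun q => by rw [blk_cubePinv, blk_cubeP, cubeInvF_cubeF]

/-- `cube^k ∘ cube^{-k} = id`. [folklore] -/
theorem cubeP_cubePinv (x : Fin (k * 3) → Bool) : cubeP k (cubePinv k x) = x :=
  eq_of_blk_eq fun q => by rw [blk_cubeP, blk_cubePinv, cubeF_cubeInvF]

/-- The template permutation with a linear term: `piL k ℓ y = cube^k(y) ⊕ ℓ`. [folklore] -/
def piL (k : ℕ) (ℓ : Fin (k * 3) → Bool) (y : Fin (k * 3) → Bool) : Fin (k * 3) → Bool := bxor (cubeP k y) ℓ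

/-- Its inverse `sigL k ℓ x = cube^{-k}(x ⊕ ℓ)`. [folklore] -/
def sigL (k : ℕ) (ℓ : Fin (k * 3) → Bool) (x : Fin (k * 3) → Bool) : Fin (k * 3) → Bool := cubePinv k (bxor x ℓ)

/-- `(c ⊕ ℓ) ⊕ ℓ = c`. [folklore] -/
theorem bxor_bxor_cancel_right (c ℓ : Fin (k * 3) → Bool) : bxor (bxor c ℓ) ℓ = c := by
  funext i
  show ((c i ^^ ℓ i) ^^ ℓ i) = c i
  cases c i <;> cases ℓ i <;> rfl

/-- `piL k ℓ` as a permutation of `𝔽₂^(k·3)` with inverse `sigL k ℓ`. [folklore] -/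
def permL (k : ℕ) (ℓ : Fin (k * 3) → Bool) : (Fin (k * 3) → Bool) ≃ (Fin (k * 3) → Bool) where
  toFun := piL k ℓ
  invFun := sigL k ℓ
  left_inv y := by
    show cubePinv k (bxor (bxor (cubeP k y) ℓ) ℓ) = y
    rw [bxor_bxor_cancel_right, cubePinv_cubeP]
  right_inv x := by
    show bxor (cubeP k (cubePinv k (bxor x ℓ))) ℓ = x
    rw [cubeP_cubePinv, bxor_bxor_cancel_right]

/-- The forward map of `permL`. [folklore] -/
@[simp] theorem permL_apply (ℓ y : Fin (k * 3) → Bool) : permL k ℓ y = piL k ℓ y := rfl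

/-- The inverse map of `permL`. [folklore] -/
@[simp] theorem permL_symm_apply (ℓ x : Fin (k * 3) → Bool) : (permL k ℓ).symm x = sigL k ℓ x := rfl

/-- Boolean bookkeeping: the linear term cancels in a bilinear differential. [folklore] -/
theorem xor4_shift (A B C D L : Bool) :
    ((A ^^ L) ^^ (B ^^ L) ^^ (C ^^ L) ^^ (D ^^ L)) = (A ^^ B ^^ C ^^ D) := by
  revert A B C D L; decide

/-- **The linear term is invisible to the bilinear differential**: `B_(piL) = B_(cube^k)`. [folklore] -/
theorem Bv_piL (ℓ t u : Fin (k * 3) → Bool) : Bv (piL k ℓ) t u = Bv (cubeP k) t u := by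
  funext i
  exact xor4_shift _ _ _ _ _

/-- `piL z ⊕ piL (z ⊕ x) = cube^k z ⊕ cube^k (z ⊕ x)`. [folklore] -/
theorem piL_pair (ℓ z x : Fin (k * 3) → Bool) :
    bxor (piL k ℓ z) (piL k ℓ (bxor z x)) = bxor (cubeP k z) (cubeP k (bxor z x)) := by
  funext i
  show ((cubeP k z i ^^ ℓ i) ^^ (cubeP k (bxor z x) i ^^ ℓ i)) = (cubeP k z i ^^ cubeP k (bxor z x) i)
  cases cubeP k z i <;> cases cubeP k (bxor z x) i <;> cases ℓ i <;> rfl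

/-- **`B_(sigL)` acts blockwise as `Bci`** (the translation by `ℓ` drops out because the inverse cube is quadratic).
[cite: Nyberg1994] -/
theorem blk_Bv_sigL (ℓ a b : Fin (k * 3) → Bool) (q : Fin k) :
    blk (Bv (sigL k ℓ) a b) q = Bci (blk a q) (blk b q) := by
  funext s
  show (sigL k ℓ (bxor a b) (finProdFinEquiv (q, s)) ^^ sigL k ℓ a (finProdFinEquiv (q, s)) ^^
      sigL k ℓ b (finProdFinEquiv (q, s)) ^^ sigL k ℓ zeroVec (finProdFinEquiv (q, s))) = _
  have e : ∀ x : Fin (k * 3) → Bool, sigL k ℓ x (finProdFinEquiv (q, s)) = cubeInvF (blk (bxor x ℓ) q) s :=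
    fun x => congrFun (blk_cubePinv (bxor x ℓ) q) s
  rw [e, e, e, e, blk_bxor, blk_bxor, blk_bxor, blk_bxor, blk_bxor, blk_zeroVec, zeroVec_bxor]
  exact Bci_shift _ _ _ _

/-- **`B_(piL)` acts blockwise as `Bc`.** [folklore] -/
theorem blk_Bv_piL (ℓ t u : Fin (k * 3) → Bool) (q : Fin k) :
    blk (Bv (piL k ℓ) t u) q = Bc (blk t q) (blk u q) := by
  rw [Bv_piL, blk_Bv]

/-- **Block nondegeneracy, `π`-side**: `B_σ(B_π(t,y), B_π(t,y₂)) = 0` for all `y, y₂` forces `t = 0`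
(`π = piL`, `σ = sigL`). [folklore] -/
theorem nd1 (ℓ t : Fin (k * 3) → Bool)
    (h : ∀ y y₂ : Fin (k * 3) → Bool, Bv (sigL k ℓ) (Bv (piL k ℓ) t y) (Bv (piL k ℓ) t y₂) = zeroVec) :
    t = zeroVec := by
  refine eq_of_blk_eq fun q => ?_
  rw [blk_zeroVec]
  refine nd1_block fun y y₂ => ?_
  have key := congrArg (fun w => blk w q) (h (embed q y) (embed q y₂))
  simpa only [blk_Bv_sigL, blk_Bv_piL, blk_embed_self, blk_zeroVec] using key

/-- **Block nondegeneracy, `σ`-side**: `B_π(B_σ(u,x), B_σ(u,x₂)) = 0` for all `x, x₂` forces `u = 0`. [folklore] -/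
theorem nd2 (ℓ u : Fin (k * 3) → Bool)
    (h : ∀ x x₂ : Fin (k * 3) → Bool, Bv (piL k ℓ) (Bv (sigL k ℓ) u x) (Bv (sigL k ℓ) u x₂) = zeroVec) :
    u = zeroVec := by
  refine eq_of_blk_eq fun q => ?_
  rw [blk_zeroVec]
  refine nd2_block fun x x₂ => ?_
  have key := congrArg (fun w => blk w q) (h (embed q x) (embed q x₂))
  simpa only [blk_Bv_sigL, blk_Bv_piL, blk_embed_self, blk_zeroVec] using key

end CubeBS

end Summit.QuantumAdvantage.QuantumAdvantage.Theorems.SignedExactCubicForrelationNotPrBPP
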